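import Summits.CriticalPhenomena.PercolationContinuityZ3.Theorems.TallClusterMassBound.Negative.MassExponentFamily

/-!
# `TallClusterMassBound` (stmt-CriticalPhenomena-0912), line `Sketch` — stub `stub_skeletonSum`

Shell bookkeeping `Σ_{x ∈ B_r} f x ≤ C r^{3-2a}` for a function `f : ℤ³ → [0,1]` with
`f x ≤ π(k)²` whenever `‖x‖∞ ≥ 2k+1` (`k ≥ 1`) and a rate `0 ≤ π(k) ≤ C₀ k^{-a}` (`0 < a ≤ 1`);
the constant is `C = 1 + 26 · (4 + 16 C₀²)`. No percolation content.

Proof. (i) Pointwise, for `1 ≤ ‖x‖∞ = m ≤ r`: `f x ≤ K r^{2-2a} / m²` with `K = 4 + 16 C₀²`.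
For `m ≥ 3` take `k = ⌊(m-1)/2⌋ ≥ 1`, so `2k+1 ≤ m ≤ 4k` and
`f x ≤ π(k)² ≤ C₀² k^{-2a}`, while `m² = m^{2a} m^{2-2a} ≤ (4k)^{2a} r^{2-2a} ≤ 16 k^{2a} r^{2-2a}`
(`sq_le_rpow_mul_rpow`); for `m ∈ {1,2}` simply `f x ≤ 1 ≤ 4 r^{2-2a} / m²`.
(ii) The lattice sum `Σ_{x ∈ B_r} ‖x‖∞^{-2} ≤ 26 r` (`sum_inv_snorm_sq_le`, origin term `0⁻¹ = 0`)
by peeling shells: `#(B_{r+1} ∖ B_r) = 24r² + 48r + 26 ≤ 26 (r+1)²` (`card_shell`).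
(iii) Split off the origin (`f 0 ≤ 1 ≤ r^{3-2a}`) and combine: `Σ f ≤ 1 + 26 K r^{3-2a}`.
-/

noncomputable section

open MeasureTheory Finset
open Literature.Probability.Percolation Literature.Probability.LatticeModels
open Summit.CriticalPhenomena.PercolationContinuityZ3.Theorems.TallClusterMassBound.Negative

namespace Summit.CriticalPhenomena.PercolationContinuityZ3.Theorems.TallClusterMassBound.AccessibleSkeleton

/-- On the shell `box 3 (r+1) \ box 3 r` the sup-norm equals `r + 1`. [folklore] -/
theorem snorm_eq_of_mem_shell {r : ℕ} {x : V3} (hx : x ∈ box 3 (r + 1) \ box 3 r) :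
    snorm x = r + 1 := by
  rw [Finset.mem_sdiff, mem_box_iff_snorm, mem_box_iff_snorm] at hx
  omega

/-- The shell `box 3 (r+1) \ box 3 r` has `(2r+3)³ - (2r+1)³ = 24r² + 48r + 26` sites. [folklore] -/
theorem card_shell (r : ℕ) :
    (#(box 3 (r + 1) \ box 3 r) : ℝ) = 24 * (r : ℝ) ^ 2 + 48 * r + 26 := by
  have h := Finset.card_sdiff_add_card_eq_card (box_mono 3 (Nat.le_succ r))
  rw [card_box, card_box] at h
  have h' := congrArg (Nat.cast : ℕ → ℝ) h
  push_cast at h'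
  linear_combination h'

/-- The lattice sum `Σ_{x ∈ B_r} ‖x‖∞⁻²` (with the origin contributing `0⁻¹ = 0`) is at most
`26 r`. [folklore] -/
theorem sum_inv_snorm_sq_le (r : ℕ) :
    ∑ x ∈ box 3 r, ((snorm x : ℝ) ^ 2)⁻¹ ≤ 26 * r := by
  induction r with
  | zero =>
    have h : ∑ x ∈ box 3 0, ((snorm x : ℝ) ^ 2)⁻¹ = 0 := by
      refine Finset.sum_eq_zero fun x hx => ?_
      rw [mem_box_iff_snorm, Nat.le_zero] at hx
      simp [hx]
    rw [h]
    simp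
  | succ r ih =>
    rw [← Finset.sum_sdiff (box_mono 3 (Nat.le_succ r))]
    have hshell : ∑ x ∈ box 3 (r + 1) \ box 3 r, ((snorm x : ℝ) ^ 2)⁻¹ =
        (24 * (r : ℝ) ^ 2 + 48 * r + 26) * (((r : ℝ) + 1) ^ 2)⁻¹ := by
      have hc : ∑ x ∈ box 3 (r + 1) \ box 3 r, ((snorm x : ℝ) ^ 2)⁻¹ =
          ∑ _x ∈ box 3 (r + 1) \ box 3 r, (((r : ℝ) + 1) ^ 2)⁻¹ := by
        refine Finset.sum_congr rfl fun x hx => ?_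
        simp [snorm_eq_of_mem_shell hx]
      rw [hc, Finset.sum_const, nsmul_eq_mul, card_shell]
    rw [hshell]
    have hpos : (0 : ℝ) < ((r : ℝ) + 1) ^ 2 := by positivity
    have hle : (24 * (r : ℝ) ^ 2 + 48 * r + 26) * (((r : ℝ) + 1) ^ 2)⁻¹ ≤ 26 := by
      rw [← div_eq_mul_inv, div_le_iff₀ hpos]
      nlinarith [sq_nonneg (r : ℝ), (Nat.cast_nonneg r : (0 : ℝ) ≤ r)]
    push_cast
    linarith

/-- `4 ^ (2a) ≤ 16` for `a ≤ 1`. [folklore] -/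
theorem four_rpow_two_mul_le {a : ℝ} (ha1 : a ≤ 1) : (4 : ℝ) ^ (2 * a) ≤ 16 := by
  calc (4 : ℝ) ^ (2 * a) ≤ (4 : ℝ) ^ ((2 : ℕ) : ℝ) :=
        Real.rpow_le_rpow_of_exponent_le (by norm_num) (by push_cast; linarith)
    _ = 16 := by rw [Real.rpow_natCast]; norm_num

/-- The real inequality behind the two-arm regime: `m² ≤ 16 k^{2a} r^{2-2a}` whenever
`0 ≤ m ≤ 4k`, `m ≤ r` and `0 ≤ a ≤ 1`. [folklore] -/
theorem sq_le_rpow_mul_rpow {a m k r : ℝ} (ha : 0 ≤ a) (ha1 : a ≤ 1) (hm : 0 ≤ m)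
    (hmk : m ≤ 4 * k) (hmr : m ≤ r) : m ^ 2 ≤ 16 * k ^ (2 * a) * r ^ (2 - 2 * a) := by
  have hk : 0 ≤ k := by linarith
  have h1 : m ^ (2 * a) ≤ 16 * k ^ (2 * a) := by
    calc m ^ (2 * a) ≤ (4 * k) ^ (2 * a) := Real.rpow_le_rpow hm hmk (by linarith)
      _ = 4 ^ (2 * a) * k ^ (2 * a) := Real.mul_rpow (by norm_num) hk
      _ ≤ 16 * k ^ (2 * a) :=
        mul_le_mul_of_nonneg_right (four_rpow_two_mul_le ha1) (Real.rpow_nonneg hk _)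
  have h2 : m ^ (2 - 2 * a) ≤ r ^ (2 - 2 * a) := Real.rpow_le_rpow hm hmr (by linarith)
  have hne : 2 * a + (2 - 2 * a) ≠ 0 := by
    rw [show 2 * a + (2 - 2 * a) = (2 : ℝ) by ring]; norm_num
  have hsplit : m ^ 2 = m ^ (2 * a) * m ^ (2 - 2 * a) := by
    rw [← Real.rpow_add' hm hne, show 2 * a + (2 - 2 * a) = ((2 : ℕ) : ℝ) by push_cast; ring,
      Real.rpow_natCast]
  rw [hsplit]
  exact mul_le_mul h1 h2 (Real.rpow_nonneg hm _) (by positivity)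

/-- `(k^{-a})² = (k^{2a})⁻¹` for `k ≥ 0`. [folklore] -/
theorem rpow_neg_sq {k a : ℝ} (hk : 0 ≤ k) : (k ^ (-a)) ^ 2 = (k ^ (2 * a))⁻¹ := by
  rw [← Real.rpow_mul_natCast hk, ← Real.rpow_neg hk]
  congr 1
  push_cast
  ring

/-- Pointwise bound: for `1 ≤ ‖x‖∞ ≤ r`, `f x ≤ K r^{2-2a} / ‖x‖∞²` with `K = 4 + 16 C₀²`.
[folklore] -/
theorem pointwise_bound {a C₀ : ℝ} (ha : 0 < a) (ha1 : a ≤ 1) {f : V3 → ℝ}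
    {π : ℕ → ℝ} (hf1 : ∀ x, f x ≤ 1) (hπ0 : ∀ k, 0 ≤ π k)
    (hfπ : ∀ (k : ℕ) (x : V3), 1 ≤ k → 2 * k + 1 ≤ snorm x → f x ≤ π k ^ 2)
    (hπC : ∀ k : ℕ, 1 ≤ k → π k ≤ C₀ * (k : ℝ) ^ (-a))
    {r : ℕ} {x : V3} (hx1 : 1 ≤ snorm x) (hxr : snorm x ≤ r) :
    f x ≤ (4 + 16 * C₀ ^ 2) * (r : ℝ) ^ (2 - 2 * a) * ((snorm x : ℝ) ^ 2)⁻¹ := by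
  have hm0 : (0 : ℝ) < snorm x := by exact_mod_cast hx1
  have hr1 : (1 : ℝ) ≤ r := by exact_mod_cast hx1.trans hxr
  have hmr : (snorm x : ℝ) ≤ r := by exact_mod_cast hxr
  have hR : (1 : ℝ) ≤ (r : ℝ) ^ (2 - 2 * a) := Real.one_le_rpow hr1 (by linarith)
  have hm2 : (0 : ℝ) < (snorm x : ℝ) ^ 2 := by positivity
  have hC : (0 : ℝ) ≤ 16 * C₀ ^ 2 * (r : ℝ) ^ (2 - 2 * a) := by positivity
  rw [← div_eq_mul_inv, le_div_iff₀ hm2]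
  by_cases h3 : 3 ≤ snorm x
  · -- two-arm regime: `k = ⌊(m-1)/2⌋`
    obtain ⟨k, hk⟩ : ∃ k : ℕ, k = (snorm x - 1) / 2 := ⟨_, rfl⟩
    have hk1 : 1 ≤ k := by omega
    have hkm : 2 * k + 1 ≤ snorm x := by omega
    have hm4k : snorm x ≤ 4 * k := by omega
    have hk0 : (0 : ℝ) < k := by exact_mod_cast hk1
    have hP : (0 : ℝ) < (k : ℝ) ^ (2 * a) := Real.rpow_pos_of_pos hk0 _
    have hfx : f x ≤ C₀ ^ 2 * ((k : ℝ) ^ (2 * a))⁻¹ := by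
      calc f x ≤ π k ^ 2 := hfπ k x hk1 hkm
        _ ≤ (C₀ * (k : ℝ) ^ (-a)) ^ 2 := pow_le_pow_left₀ (hπ0 k) (hπC k hk1) 2
        _ = C₀ ^ 2 * ((k : ℝ) ^ (2 * a))⁻¹ := by rw [mul_pow, rpow_neg_sq hk0.le]
    have hkey : (snorm x : ℝ) ^ 2 ≤ 16 * (k : ℝ) ^ (2 * a) * (r : ℝ) ^ (2 - 2 * a) :=
      sq_le_rpow_mul_rpow ha.le ha1 hm0.le (by exact_mod_cast hm4k) hmr
    calc f x * (snorm x : ℝ) ^ 2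
        ≤ C₀ ^ 2 * ((k : ℝ) ^ (2 * a))⁻¹ * (snorm x : ℝ) ^ 2 :=
          mul_le_mul_of_nonneg_right hfx hm2.le
      _ ≤ C₀ ^ 2 * ((k : ℝ) ^ (2 * a))⁻¹ * (16 * (k : ℝ) ^ (2 * a) * (r : ℝ) ^ (2 - 2 * a)) :=
          mul_le_mul_of_nonneg_left hkey (by positivity)
      _ = 16 * C₀ ^ 2 * (r : ℝ) ^ (2 - 2 * a) * (((k : ℝ) ^ (2 * a))⁻¹ * (k : ℝ) ^ (2 * a)) := by
          ring
      _ = 16 * C₀ ^ 2 * (r : ℝ) ^ (2 - 2 * a) := by rw [inv_mul_cancel₀ hP.ne', mul_one]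
      _ ≤ (4 + 16 * C₀ ^ 2) * (r : ℝ) ^ (2 - 2 * a) := by nlinarith [hR, hC]
  · -- `‖x‖∞ ∈ {1, 2}`: the trivial bound `f x ≤ 1`
    have hm2' : (snorm x : ℝ) ≤ 2 := by exact_mod_cast (by omega : snorm x ≤ 2)
    have hsq : (snorm x : ℝ) ^ 2 ≤ 4 := by nlinarith [hm0, hm2']
    calc f x * (snorm x : ℝ) ^ 2 ≤ 1 * 4 := mul_le_mul (hf1 x) hsq hm2.le zero_le_one
      _ ≤ (4 + 16 * C₀ ^ 2) * (r : ℝ) ^ (2 - 2 * a) := by nlinarith [hR, hC]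

/-- **Shell bookkeeping** (registered stub `stub_skeletonSum` of line `Sketch`): for
`f : ℤ³ → [0,1]` with `f x ≤ π(k)²` on `‖x‖∞ ≥ 2k+1` (`k ≥ 1`) and `0 ≤ π(k) ≤ C₀ k^{-a}`
(`0 < a ≤ 1`), `Σ_{x ∈ B_r} f x ≤ C r^{3-2a}` for all `r ≥ 1`, with `C = 1 + 26 (4 + 16 C₀²)`
depending only on `a, C₀`. [folklore] -/
theorem stub_skeletonSum :
    ∀ (a C₀ : ℝ), 0 < a → a ≤ 1 → 0 ≤ C₀ →
      ∃ C : ℝ, ∀ (f : V3 → ℝ) (π : ℕ → ℝ),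
        (∀ x, 0 ≤ f x) → (∀ x, f x ≤ 1) → (∀ k, 0 ≤ π k) →
        (∀ (k : ℕ) (x : V3), 1 ≤ k → 2 * k + 1 ≤ snorm x → f x ≤ π k ^ 2) →
        (∀ k : ℕ, 1 ≤ k → π k ≤ C₀ * (k : ℝ) ^ (-a)) →
        ∀ r : ℕ, 1 ≤ r → ∑ x ∈ box 3 r, f x ≤ C * (r : ℝ) ^ (3 - 2 * a) := by
  intro a C₀ ha ha1 _hC₀
  refine ⟨1 + 26 * (4 + 16 * C₀ ^ 2), fun f π _hf0 hf1 hπ0 hfπ hπC r hr => ?_⟩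
  have hK0 : (0 : ℝ) ≤ 4 + 16 * C₀ ^ 2 := by positivity
  have hr0 : (0 : ℝ) < r := by exact_mod_cast hr
  have hr1 : (1 : ℝ) ≤ r := by exact_mod_cast hr
  have hR : (0 : ℝ) ≤ (r : ℝ) ^ (2 - 2 * a) := Real.rpow_nonneg hr0.le _
  -- split off the origin `box 3 0`
  rw [← Finset.sum_sdiff (box_mono 3 (Nat.zero_le r))]
  have h0 : ∑ x ∈ box 3 0, f x ≤ 1 := by
    calc ∑ x ∈ box 3 0, f x ≤ ∑ _x ∈ box 3 0, (1 : ℝ) := Finset.sum_le_sum fun x _ => hf1 x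
      _ = 1 := by rw [Finset.sum_const, card_box]; simp
  have h1 : ∑ x ∈ box 3 r \ box 3 0, f x ≤
      (4 + 16 * C₀ ^ 2) * (r : ℝ) ^ (2 - 2 * a) * (26 * r) := by
    calc ∑ x ∈ box 3 r \ box 3 0, f x
        ≤ ∑ x ∈ box 3 r \ box 3 0,
            (4 + 16 * C₀ ^ 2) * (r : ℝ) ^ (2 - 2 * a) * ((snorm x : ℝ) ^ 2)⁻¹ := by
          refine Finset.sum_le_sum fun x hx => ?_
          rw [Finset.mem_sdiff, mem_box_iff_snorm, mem_box_iff_snorm] at hx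
          exact pointwise_bound ha ha1 hf1 hπ0 hfπ hπC (by omega) hx.1
      _ ≤ ∑ x ∈ box 3 r, (4 + 16 * C₀ ^ 2) * (r : ℝ) ^ (2 - 2 * a) * ((snorm x : ℝ) ^ 2)⁻¹ :=
          Finset.sum_le_sum_of_subset_of_nonneg Finset.sdiff_subset fun x _ _ => by positivity
      _ = (4 + 16 * C₀ ^ 2) * (r : ℝ) ^ (2 - 2 * a) * ∑ x ∈ box 3 r, ((snorm x : ℝ) ^ 2)⁻¹ := by
          rw [Finset.mul_sum]
      _ ≤ (4 + 16 * C₀ ^ 2) * (r : ℝ) ^ (2 - 2 * a) * (26 * r) :=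
          mul_le_mul_of_nonneg_left (sum_inv_snorm_sq_le r) (by positivity)
  have hpow : (r : ℝ) ^ (2 - 2 * a) * r = (r : ℝ) ^ (3 - 2 * a) := by
    rw [← Real.rpow_add_one hr0.ne']
    congr 1
    ring
  have hone : (1 : ℝ) ≤ (r : ℝ) ^ (3 - 2 * a) := Real.one_le_rpow hr1 (by linarith)
  have hKR : (0 : ℝ) ≤ (4 + 16 * C₀ ^ 2) * (r : ℝ) ^ (3 - 2 * a) := by positivity
  calc ∑ x ∈ box 3 r \ box 3 0, f x + ∑ x ∈ box 3 0, f x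
      ≤ (4 + 16 * C₀ ^ 2) * (r : ℝ) ^ (2 - 2 * a) * (26 * r) + 1 := add_le_add h1 h0
    _ = 26 * ((4 + 16 * C₀ ^ 2) * (r : ℝ) ^ (3 - 2 * a)) + 1 := by rw [← hpow]; ring
    _ ≤ (1 + 26 * (4 + 16 * C₀ ^ 2)) * (r : ℝ) ^ (3 - 2 * a) := by nlinarith [hone, hKR]

end Summit.CriticalPhenomena.PercolationContinuityZ3.Theorems.TallClusterMassBound.AccessibleSkeleton
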